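import Summits.NavierStokesRegularity.NavierStokesRegularity.Theorems.LerayQuarterDissipationFiniteDissipationLiouvilleCalmSliceLocal
import HarnessLib

/-!
# Crux `FiniteDissipationLiouville` (stmt-NavierStokesRegularity-22144): ONE CALM PARABOLIC
# SUB-BALL ANYWHERE ⇒ REGULAR; the flicker of a finite-dissipation Type-I singularity is
# spatially dense at every instant

Theorems file of route `LerayQuarterDissipation` (lead prover g14; `--supports` the crux; sequel of
`…CalmSliceLocal`, portrait facts for the registered stub `stub_envelopeCriticalLiouville` of
skeleton v28). Navier–Stokes regularity is NOT proved by anything here; no summit is.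
`𝒟_{C,K}` = Type-I ancient mild fields (KNSS gauge) with the law `∫‖∇w(s)‖² ≤ K/√(−s)`; the
UNSTEADINESS of `w` at `(t,x)` is `√(−t) • ((−t)∂ₜw − ½w − ½(x·∇)w)(t,x)` (`= ∂ₛU` of the
similarity profile, Pineau–Vicol 2026 §1.3).

* `abs_weakUnsteadiness_le_of_calm_ball` — the centred form of
  `CalmSlice.abs_weakUnsteadiness_le_of_calm`: calmness `≤ δ` on a ball `B(c, r)` bounds the weak
  unsteadiness functional by `δ‖ψ‖₁` for solenoidal tests supported there.
* `slice_eq_zero_of_curlFree_unsteadiness_on` — **NO OPEN REGION OF A SLICE IS STEADY MODULO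
  PRESSURE**: curl-free unsteadiness (`∂ₛU = ∇π` locally, i.e. Leray's steady profile system on an
  open set for a modified pressure) on ONE non-empty open set of ONE slice kills a member of `𝒟`
  (analytic continuation of `DG − DGᵀ`, `fderiv_unsteadiness_symm_of_symm_on`).
* `localCalm_leaf` — **ONE CALM PARABOLIC SUB-BALL ANYWHERE ⇒ REGULAR APEX.** For all `C, K`, every
  similarity radius `ρ` and every sub-ball radius `r > 0` there is `δ = δ(C,K,ρ,r) > 0` such that
  a member of `𝒟_{C,K}` whose unsteadiness is `≤ δ` on ONE ball `B(x₀, r√(−t))` with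
  `‖x₀‖ ≤ ρ√(−t)`, at ONE instant `t < 0`, is bounded on some backward parabolic cylinder at the
  apex. Compared with the tree's `CalmSlice.calmSlice_leaf` (= `CalmSliceGate.OneCalmSlice`, whose
  ball `B(0, R(C,K)√(−t))` is chosen by the theorem) the ball is now ARBITRARY: any centre in the
  similarity region, any parabolic radius. Proof: contradiction sequence; rescale the instants to
  `−1` (`CalmSlice.unsteadiness_nsRescale`); Bolzano for the centres in `B̄(0,ρ)`; KNSS
  compactness across members (`Compactness.seqLimit`) with the law of the limit and persistence
  of the singularity; the derivative-free weak unsteadiness passes to the limit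
  (`CalmSlice.tendsto_weakUnsteadiness`) and vanishes on the solenoidal tests supported in the
  half-ball around the limit centre; the LOCAL weak-steadiness Liouville
  `CalmSliceLocal.slice_eq_zero_of_weakSteady_on` (analyticity of the unsteadiness + local
  de Rham + Leray's profile system + Tsai) kills the limit slice; forward uniqueness contradicts
  persistence.
* `localFlicker_floor_of_singular` — PORTRAIT: **NO CALM POCKET OF ANY PARABOLIC SIZE.** Every
  singular member of `𝒟_{C,K}` — DSS or wandering, in particular every critical element — has, at
  EVERY instant `t < 0` and in EVERY ball `B(x₀, r√(−t))` with `‖x₀‖ ≤ ρ√(−t)`, a point where the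
  unsteadiness exceeds `δ(C,K,ρ,r)`: the flicker of a finite-dissipation Type-I singularity is
  spatially dense in the whole similarity region, uniformly on the stratum.

HONEST FRAMING: portrait facts with an ineffective `δ` (compactness), degrading as `ρ → ∞` or
`r → 0`; nothing is removed for the DSS wall; the crux stays blocked on
`∀ c > 1, TypeIDSSLiouville c` (NECESSARY, `…Hardness`).

References: Pineau–Vicol, arXiv:2607.09619 (2026) Thm 1.9, §1.3; Tsai, ARMA 143 (1998) Thm 1;
Koch–Nadirashvili–Seregin–Šverák, Acta Math. 203 (2009) = arXiv:0709.3599 §4; Chae–Wolf,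
arXiv:1610.09464 (compactness–rigidity pattern).
-/

noncomputable section

-- the summit and its single sub-problem share the name (CONVENTIONS §1), as in every Theorems file
set_option linter.dupNamespace false

namespace Summit.NavierStokesRegularity.NavierStokesRegularity.Theorems.FiniteDissipationLiouville.CalmSliceLocal

open MeasureTheory Set Filter Topology Metric Function TopologicalSpace InnerProductSpace
open Literature.Analysis Literature.Analysis.FluidPDE
open Summit.NavierStokesRegularity.NavierStokesRegularity.Theorems
open Summit.NavierStokesRegularity.NavierStokesRegularity.Theorems.FiniteDissipationLiouville
open Summit.NavierStokesRegularity.NavierStokesRegularity.Theorems.FiniteDissipationLiouville.CalmSlice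
open scoped ENNReal NNReal RealInnerProductSpace Laplacian ContDiff

/-! ### Calm balls have small weak unsteadiness (centred form) -/

/-- **Calm sub-balls have small weak unsteadiness** (centred form of
`CalmSlice.abs_weakUnsteadiness_le_of_calm`): if the unsteadiness field of the slice `−1` is
`≤ δ` on `B(c, r)` and the solenoidal test `ψ ∈ C²_c` is supported in `B(c, r)`, then
`|∫ (⟪U,(U·∇)ψ⟫ + ⟪U,Δψ⟫ + ⟪U,ψ⟫ + ½⟪U,(y·∇)ψ⟫)| ≤ δ ∫‖ψ‖`. [cite: Leray1934, (17) p. 206] -/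
theorem abs_weakUnsteadiness_le_of_calm_ball {C : ℝ}
    {w : ℝ → EuclideanSpace ℝ (Fin 3) → EuclideanSpace ℝ (Fin 3)}
    (hw : IsTypeIAncientMild C w) {δ r : ℝ} {c : EuclideanSpace ℝ (Fin 3)}
    (hcalm : ∀ y ∈ ball c r,
      ‖deriv (fun τ => w τ y) (-1) - (1 / 2 : ℝ) • w (-1) y -
        (1 / 2 : ℝ) • fderiv ℝ (w (-1)) y y‖ ≤ δ)
    {ψ : EuclideanSpace ℝ (Fin 3) → EuclideanSpace ℝ (Fin 3)}
    (hψ : ContDiff ℝ 2 ψ) (hc : HasCompactSupport ψ) (hdiv : VectorCalculus.IsDivFree ψ)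
    (hsupp : tsupport ψ ⊆ ball c r) :
    |∫ y, (⟪w (-1) y, convect (w (-1)) ψ y⟫ + ⟪w (-1) y, (Δ ψ) y⟫ + ⟪w (-1) y, ψ y⟫ +
        (1 / 2 : ℝ) * ⟪w (-1) y, fderiv ℝ ψ y y⟫)| ≤ δ * ∫ y, ‖ψ y‖ := by
  -- adapted from `CalmSlice.abs_weakUnsteadiness_le_of_calm` (ball centred at `0`)
  rw [← integral_inner_unsteadiness_eq hw hψ hc hdiv, ← Real.norm_eq_abs, ← integral_const_mul]
  refine norm_integral_le_of_norm_le ((hψ.continuous.norm.integrable_of_hasCompactSupport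
    hc.norm).const_mul δ) (Eventually.of_forall fun y => ?_)
  by_cases hy : y ∈ ball c r
  · exact (norm_inner_le_norm _ _).trans (mul_le_mul_of_nonneg_right (hcalm y hy) (norm_nonneg _))
  · have h0 : ψ y = 0 := image_eq_zero_of_notMem_tsupport fun h => hy (hsupp h)
    simp [h0]

/-! ### No open region of a slice is steady modulo pressure -/

/-- **Curl-free unsteadiness on ONE open set ⇒ curl-free everywhere.** If the derivative of the
unsteadiness field `G` of the slice `−1` of a class member is symmetric at every point of ONE
non-empty open set `O`, it is symmetric everywhere (the entries of `DG − DGᵀ` are real-analytic,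
`analyticOnNhd_unsteadiness`; identity theorem). [cite: LemarieRieusset2016, Thm. 9.12 (PDF p. 260)] -/
theorem fderiv_unsteadiness_symm_of_symm_on {C : ℝ}
    {w : ℝ → EuclideanSpace ℝ (Fin 3) → EuclideanSpace ℝ (Fin 3)} (hw : IsTypeIAncientMild C w)
    {O : Set (EuclideanSpace ℝ (Fin 3))} (hO : IsOpen O) (hne : O.Nonempty)
    (hloc : ∀ y ∈ O, ∀ a b : EuclideanSpace ℝ (Fin 3),
      ⟪fderiv ℝ (fun y => deriv (fun τ => w τ y) (-1) - (1 / 2 : ℝ) • w (-1) y -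
          (1 / 2 : ℝ) • fderiv ℝ (w (-1)) y y) y a, b⟫ =
        ⟪fderiv ℝ (fun y => deriv (fun τ => w τ y) (-1) - (1 / 2 : ℝ) • w (-1) y -
          (1 / 2 : ℝ) • fderiv ℝ (w (-1)) y y) y b, a⟫)
    (x v v' : EuclideanSpace ℝ (Fin 3)) :
    ⟪fderiv ℝ (fun y => deriv (fun τ => w τ y) (-1) - (1 / 2 : ℝ) • w (-1) y -
        (1 / 2 : ℝ) • fderiv ℝ (w (-1)) y y) x v, v'⟫ =
      ⟪fderiv ℝ (fun y => deriv (fun τ => w τ y) (-1) - (1 / 2 : ℝ) • w (-1) y -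
        (1 / 2 : ℝ) • fderiv ℝ (w (-1)) y y) x v', v⟫ := by
  -- the analytic-continuation step of `fderiv_unsteadiness_symm_of_weakSteady_on`
  set G : EuclideanSpace ℝ (Fin 3) → EuclideanSpace ℝ (Fin 3) := fun y =>
    deriv (fun τ => w τ y) (-1) - (1 / 2 : ℝ) • w (-1) y - (1 / 2 : ℝ) • fderiv ℝ (w (-1)) y y
    with hGdef
  have hGa : AnalyticOnNhd ℝ G univ := analyticOnNhd_unsteadiness hw
  have hD : AnalyticOnNhd ℝ (fderiv ℝ G) univ := hGa.fderiv
  have hent : ∀ a b : EuclideanSpace ℝ (Fin 3),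
      AnalyticOnNhd ℝ (fun y => ⟪b, fderiv ℝ G y a⟫) univ := by
    intro a b
    have h2 : AnalyticOnNhd ℝ (fun y => fderiv ℝ G y a) univ :=
      (ContinuousLinearMap.apply ℝ (EuclideanSpace ℝ (Fin 3)) a).comp_analyticOnNhd hD
    exact (innerSL ℝ b).comp_analyticOnNhd h2
  set m : EuclideanSpace ℝ (Fin 3) → ℝ := fun y => ⟪v', fderiv ℝ G y v⟫ - ⟪v, fderiv ℝ G y v'⟫
    with hmdef
  have hm : AnalyticOnNhd ℝ m univ := (hent v v').sub (hent v' v)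
  obtain ⟨z₀, hz₀⟩ := hne
  have hev : m =ᶠ[𝓝 z₀] 0 := by
    filter_upwards [hO.mem_nhds hz₀] with y hy
    show ⟪v', fderiv ℝ G y v⟫ - ⟪v, fderiv ℝ G y v'⟫ = 0
    rw [real_inner_comm (fderiv ℝ G y v) v', real_inner_comm (fderiv ℝ G y v') v, hloc y hy v v',
      sub_self]
  have hzero : m x = 0 :=
    hm.eqOn_zero_of_preconnected_of_eventuallyEq_zero (convex_univ).isPreconnected (mem_univ z₀)
      hev (mem_univ x)
  change ⟪v', fderiv ℝ G x v⟫ - ⟪v, fderiv ℝ G x v'⟫ = 0 at hzero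
  have h' : ⟪v', fderiv ℝ G x v⟫ = ⟪v, fderiv ℝ G x v'⟫ := sub_eq_zero.1 hzero
  rw [real_inner_comm v' (fderiv ℝ G x v), real_inner_comm v (fderiv ℝ G x v')]
  exact h'

/-- **NO OPEN REGION OF A SLICE IS STEADY MODULO PRESSURE.** If the unsteadiness field
`G = ∂ₜw(−1,·) − ½w(−1,·) − ½Dw(−1)[y]` of a member of `𝒟_{C,K}` is CURL-FREE on ONE non-empty
open set `O` (symmetric `DG` there — locally `∂ₛU = ∇π`, i.e. the similarity profile satisfies
Leray's STEADY profile system on `O` for a modified pressure), then the slice vanishes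
(`fderiv_unsteadiness_symm_of_symm_on` + `slice_eq_zero_of_fderiv_unsteadiness_symm`). Strictly
stronger than pointwise steadiness on `O`. [cite: Tsai1998, Theorem 1 (p. 31)] -/
theorem slice_eq_zero_of_curlFree_unsteadiness_on {C K : ℝ}
    {w : ℝ → EuclideanSpace ℝ (Fin 3) → EuclideanSpace ℝ (Fin 3)}
    (hw : IsTypeIAncientMild C w)
    (hlaw : ∀ s : ℝ, s < 0 → ∫⁻ x, ‖fderiv ℝ (w s) x‖ₑ ^ 2 ≤ ENNReal.ofReal (K / Real.sqrt (-s)))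
    {O : Set (EuclideanSpace ℝ (Fin 3))} (hO : IsOpen O) (hne : O.Nonempty)
    (hloc : ∀ y ∈ O, ∀ a b : EuclideanSpace ℝ (Fin 3),
      ⟪fderiv ℝ (fun y => deriv (fun τ => w τ y) (-1) - (1 / 2 : ℝ) • w (-1) y -
          (1 / 2 : ℝ) • fderiv ℝ (w (-1)) y y) y a, b⟫ =
        ⟪fderiv ℝ (fun y => deriv (fun τ => w τ y) (-1) - (1 / 2 : ℝ) • w (-1) y -
          (1 / 2 : ℝ) • fderiv ℝ (w (-1)) y y) y b, a⟫) :
    ∀ x, w (-1) x = 0 :=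
  slice_eq_zero_of_fderiv_unsteadiness_symm hw hlaw
    (fderiv_unsteadiness_symm_of_symm_on hw hO hne hloc)

/-! ### One calm parabolic sub-ball anywhere ⇒ regular apex -/

/-- **ONE CALM PARABOLIC SUB-BALL ANYWHERE ⇒ REGULAR APEX.** For all `C, K`, every similarity
radius `ρ` and every sub-ball radius `r > 0` there is `δ > 0` such that: a Type-I ancient mild field
`w` (constant `C`) with the finite-dissipation law (constant `K`) whose unsteadiness
`‖√(−t)((−t)∂ₜw − ½w − ½(x·∇)w)‖` is `≤ δ` on ONE ball `B(x₀, r√(−t))` with `‖x₀‖ ≤ ρ√(−t)`, at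
ONE instant `t < 0`, is bounded on some backward parabolic cylinder at the origin. (Compactness
across members + Bolzano for the rescaled centres + the local weak-steadiness Liouville
`slice_eq_zero_of_weakSteady_on` + forward uniqueness.) [cite: Tsai1998, Theorem 1 (p. 31)] -/
theorem localCalm_leaf (C K ρ r : ℝ) (hr : 0 < r) : ∃ δ > 0,
    ∀ (w : ℝ → EuclideanSpace ℝ (Fin 3) → EuclideanSpace ℝ (Fin 3)),
      IsTypeIAncientMild C w →
      (∀ s : ℝ, s < 0 → ∫⁻ x, ‖fderiv ℝ (w s) x‖ₑ ^ 2 ≤ ENNReal.ofReal (K / Real.sqrt (-s))) →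
      ∀ t < 0, ∀ x₀ : EuclideanSpace ℝ (Fin 3), ‖x₀‖ ≤ ρ * Real.sqrt (-t) →
      (∀ x ∈ ball x₀ (r * Real.sqrt (-t)),
        ‖Real.sqrt (-t) • ((-t) • deriv (fun τ => w τ x) t - (1 / 2 : ℝ) • w t x -
          (1 / 2 : ℝ) • fderiv ℝ (w t) x x)‖ ≤ δ) →
      ¬ (∀ r > 0, ∀ M : ℝ, ∃ t ∈ Set.Ioo (-(r ^ 2)) (0 : ℝ),
        ∃ x ∈ Metric.ball (0 : EuclideanSpace ℝ (Fin 3)) r, M < ‖w t x‖) := by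
  by_contra hcon
  push Not at hcon
  -- ## a contradiction sequence, calm sub-balls rescaled to the slice `-1`
  have hk : ∀ k : ℕ, ∃ (v : ℝ → EuclideanSpace ℝ (Fin 3) → EuclideanSpace ℝ (Fin 3))
      (c : EuclideanSpace ℝ (Fin 3)),
      IsTypeIAncientMild C v ∧
      (∀ s : ℝ, s < 0 → ∫⁻ x, ‖fderiv ℝ (v s) x‖ₑ ^ 2 ≤ ENNReal.ofReal (K / Real.sqrt (-s))) ∧
      (∀ r > 0, ∀ M : ℝ, ∃ t ∈ Ioo (-(r ^ 2)) (0 : ℝ),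
        ∃ x ∈ ball (0 : EuclideanSpace ℝ (Fin 3)) r, M < ‖v t x‖) ∧
      c ∈ closedBall (0 : EuclideanSpace ℝ (Fin 3)) ρ ∧
      (∀ y ∈ ball c r,
        ‖deriv (fun τ => v τ y) (-1) - (1 / 2 : ℝ) • v (-1) y -
          (1 / 2 : ℝ) • fderiv ℝ (v (-1)) y y‖ ≤ 1 / ((k : ℝ) + 1)) := by
    intro k
    obtain ⟨w, hw, hlaw, t, ht, x₀, hx₀, hcalm, hsing⟩ := hcon (1 / ((k : ℝ) + 1)) (by positivity)
    set μ : ℝ := Real.sqrt (-t) with hμdef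
    have hμ : 0 < μ := Real.sqrt_pos.2 (neg_pos.2 ht)
    refine ⟨nsRescale μ w, μ⁻¹ • x₀, isTypeIAncientMild_nsRescale hw hμ,
      RecurrentReductionD.dissipationLaw_nsRescale hlaw hμ,
      RecurrentReductionD.singularAtOrigin_nsRescale hsing hμ, ?_, fun y hy => ?_⟩
    · rw [mem_closedBall_zero_iff, norm_smul, norm_inv, Real.norm_of_nonneg hμ.le,
        inv_mul_le_iff₀ hμ, mul_comm]
      exact hx₀
    · rw [hμdef, unsteadiness_nsRescale hw ht y]
      refine hcalm (Real.sqrt (-t) • y) ?_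
      rw [mem_ball, dist_eq_norm] at hy ⊢
      have e : Real.sqrt (-t) • y - x₀ = Real.sqrt (-t) • (y - (Real.sqrt (-t))⁻¹ • x₀) := by
        rw [smul_sub, smul_smul, mul_inv_cancel₀ hμ.ne', one_smul]
      rw [e, norm_smul, Real.norm_of_nonneg hμ.le, mul_comm]
      exact mul_lt_mul_of_pos_right hy hμ
  choose v c hv hlaw hsing hc hcalm using hk
  -- ## Bolzano for the centres, then compactness across members
  obtain ⟨cs, -, φ, hφ, hclim⟩ := (isCompact_closedBall (0 : EuclideanSpace ℝ (Fin 3)) ρ).tendsto_subseq hc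
  obtain ⟨ψ, hψ, W, hW, hunif, hpt, hgrad⟩ := Compactness.seqLimit (fun j => hv (φ j))
  have hψt : Tendsto ψ atTop atTop := hψ.tendsto_atTop
  have hφψt : Tendsto (fun j => φ (ψ j)) atTop atTop := hφ.tendsto_atTop.comp hψt
  have hclim' : Tendsto (fun j => c (φ (ψ j))) atTop (𝓝 cs) := hclim.comp hψt
  have hWlaw : ∀ s : ℝ, s < 0 →
      ∫⁻ x, ‖fderiv ℝ (W s) x‖ₑ ^ 2 ≤ ENNReal.ofReal (K / Real.sqrt (-s)) :=
    Compactness.law_of_seqLimit (Kk := fun _ => K) (Kinf := K) (w := fun j => v (φ j)) hψt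
      (fun j => hlaw (φ j)) (fun ε hε => Eventually.of_forall fun k => by linarith) hgrad
  have hWsing := Compactness.persistent_singularity_seq (w := fun j => v (φ (ψ j)))
    (fun j => hv _) (fun j => hlaw _) (fun j => hsing _) hW hunif
  -- ## the weak unsteadiness of the limit slice vanishes on the tests supported in `B(c_*, r/2)`
  have hweak : ∀ χ : EuclideanSpace ℝ (Fin 3) → EuclideanSpace ℝ (Fin 3), ContDiff ℝ ∞ χ →
      HasCompactSupport χ → tsupport χ ⊆ ball cs (r / 2) → VectorCalculus.IsDivFree χ →
      ∫ y, (⟪W (-1) y, convect (W (-1)) χ y⟫ + ⟪W (-1) y, (Δ χ) y⟫ + ⟪W (-1) y, χ y⟫ +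
        (1 / 2 : ℝ) * ⟪W (-1) y, fderiv ℝ χ y y⟫) = 0 := by
    intro χ hχ hcχ hsuppχ hdiv
    have hχ2 : ContDiff ℝ 2 χ := contDiff_infty.1 hχ 2
    have hlim := tendsto_weakUnsteadiness (v := fun j => v (φ (ψ j))) (W := W) (fun j => hv _)
      (hpt (-1) (by norm_num)) hχ2 hcχ
    -- eventually the half-ball around `c_*` lies in the calm ball around `c (φ (ψ j))`
    have hev : ∀ᶠ j in atTop, ball cs (r / 2) ⊆ ball (c (φ (ψ j))) r := by
      have hd : ∀ᶠ j in atTop, dist (c (φ (ψ j))) cs < r / 2 :=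
        (tendsto_iff_dist_tendsto_zero.1 hclim').eventually (gt_mem_nhds (by positivity))
      filter_upwards [hd] with j hj
      intro y hy
      rw [mem_ball] at hy ⊢
      calc dist y (c (φ (ψ j))) ≤ dist y cs + dist cs (c (φ (ψ j))) := dist_triangle _ _ _
        _ < r / 2 + r / 2 := add_lt_add hy (by rwa [dist_comm])
        _ = r := by ring
    have hsmall : ∀ᶠ j in atTop, ‖∫ y, (⟪v (φ (ψ j)) (-1) y, convect (v (φ (ψ j)) (-1)) χ y⟫ +
        ⟪v (φ (ψ j)) (-1) y, (Δ χ) y⟫ + ⟪v (φ (ψ j)) (-1) y, χ y⟫ +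
        (1 / 2 : ℝ) * ⟪v (φ (ψ j)) (-1) y, fderiv ℝ χ y y⟫)‖ ≤
        (1 / (((φ (ψ j) : ℕ) : ℝ) + 1)) * ∫ y, ‖χ y‖ := by
      filter_upwards [hev] with j hj
      rw [Real.norm_eq_abs]
      exact abs_weakUnsteadiness_le_of_calm_ball (hv _) (hcalm (φ (ψ j))) hχ2 hcχ hdiv
        (hsuppχ.trans hj)
    have hzero : Tendsto (fun j => ∫ y, (⟪v (φ (ψ j)) (-1) y, convect (v (φ (ψ j)) (-1)) χ y⟫ +
        ⟪v (φ (ψ j)) (-1) y, (Δ χ) y⟫ + ⟪v (φ (ψ j)) (-1) y, χ y⟫ +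
        (1 / 2 : ℝ) * ⟪v (φ (ψ j)) (-1) y, fderiv ℝ χ y y⟫)) atTop (𝓝 0) := by
      refine squeeze_zero_norm' hsmall ?_
      have h0 : Tendsto (fun j => 1 / ((((φ (ψ j)) : ℕ) : ℝ) + 1)) atTop (𝓝 0) :=
        tendsto_one_div_add_atTop_nhds_zero_nat.comp hφψt
      simpa using h0.mul_const (∫ y, ‖χ y‖)
    exact tendsto_nhds_unique hlim hzero
  -- ## the limit slice vanishes; forward uniqueness contradicts persistence
  have hW0 : ∀ x, W (-1) x = 0 :=
    slice_eq_zero_of_weakSteady_on hW hWlaw isOpen_ball ⟨cs, mem_ball_self (by positivity)⟩ hweak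
  exact not_singular_of_zero_slice hW (by norm_num) hW0 hWsing

/-- **PORTRAIT: no calm pocket of any parabolic size — the flicker of a finite-dissipation Type-I
singularity is spatially dense at every instant.** For every SINGULAR member of `𝒟_{C,K}` (DSS
or wandering; in particular every critical element), every instant `t < 0` and every centre `x₀`
with `‖x₀‖ ≤ ρ√(−t)`, some point of `B(x₀, r√(−t))` has unsteadiness `> δ(C,K,ρ,r)`. -/
theorem localFlicker_floor_of_singular (C K ρ r : ℝ) (hr : 0 < r) : ∃ δ > 0,
    ∀ (w : ℝ → EuclideanSpace ℝ (Fin 3) → EuclideanSpace ℝ (Fin 3)),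
      IsTypeIAncientMild C w →
      (∀ s : ℝ, s < 0 → ∫⁻ x, ‖fderiv ℝ (w s) x‖ₑ ^ 2 ≤ ENNReal.ofReal (K / Real.sqrt (-s))) →
      (∀ r > 0, ∀ M : ℝ, ∃ t ∈ Set.Ioo (-(r ^ 2)) (0 : ℝ),
        ∃ x ∈ Metric.ball (0 : EuclideanSpace ℝ (Fin 3)) r, M < ‖w t x‖) →
      ∀ t < 0, ∀ x₀ : EuclideanSpace ℝ (Fin 3), ‖x₀‖ ≤ ρ * Real.sqrt (-t) →
        ∃ x ∈ ball x₀ (r * Real.sqrt (-t)),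
          δ < ‖Real.sqrt (-t) • ((-t) • deriv (fun τ => w τ x) t - (1 / 2 : ℝ) • w t x -
            (1 / 2 : ℝ) • fderiv ℝ (w t) x x)‖ := by
  obtain ⟨δ, hδ, h⟩ := localCalm_leaf C K ρ r hr
  refine ⟨δ, hδ, fun w hw hlaw hsing t ht x₀ hx₀ => ?_⟩
  by_contra hnot
  push Not at hnot
  exact h w hw hlaw t ht x₀ hx₀ hnot hsing

end Summit.NavierStokesRegularity.NavierStokesRegularity.Theorems.FiniteDissipationLiouville.CalmSliceLocal

end
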